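/-
Copyright (c) 2026 the pub-hodgecm-mathlib formalisation cell (harness21).  Prover seat hodgecm-mathlib-K2Liu-p03 (g6): Track B «K2-LIT»,
#184♮ = hLiu418 = stmt-HodgeConjecture-24832, road `K2_Liu`, Road I organ (A-int)-fin, A7-reg = the Gindikin–Karpelevich COCYCLE road
(RULINGS M-156m ∕ M-156m′: B1 → B2 → B3 to this hand), file B1a (heads `K2/K2Liu-p03/g6/HEADS-B1-BorelFrame.K2Liu-p03-g6.md` 5178151889657773).
-/
import Literature.NumberTheory.Automorphic.UnitaryGroupAutomorphicRep   -- ★ `unitaryGroupOfForm`, `StdForm.antidiagonal`, `StdForm.over`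
import Mathlib.Data.Matrix.Mul
import Mathlib.LinearAlgebra.Matrix.NonsingularInverse
import HarnessLib

/-!
# Crux `HLiu418`, road `K2_Liu`, organ (A-int)-fin, A7-reg file B1a-1: THE BOREL FRAME OF `U(J₄)` — the form, the four positive root letters and the torus
# (pure algebra over a commutative ring with involution; Weyl letters and the cocycle word in B1a-2)

Cell `hodgecm-mathlib`, crux item hLiu418 = `stmt-HodgeConjecture-24832`; squad K2 ∕ K2Liu; prover K2Liu-p03 (g6).  DEFINITIONS WITH BODIES + their
algebra (review lane `--kind definition`, `--supports stmt-HodgeConjecture-24832 --as helper`); no `instance`, no notation, no named-fact hypothesis, no `sorry`.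

SETTING.  `R` a commutative ring with a ring endomorphism `σ` (involutive where stated: `hσ : ∀ x, σ (σ x) = x`), `J = J₄ = antidiag(1,1,1,1)` (Mok's form
★ `(StdForm.antidiagonal 4).over R`, entries `J i j = [j = rev i]`), `G = U(J₄)(R, σ) = {g ∈ GL₄(R) : σ(g)ᵀ J g = J}` (★ `unitaryGroupOfForm σ J`).  At a finite
place `v` of the quadratic extension `E/F` of the Road I sheet this is instantiated with `R := E ⊗_F F_v = LocalRing E v`, `σ := conjLocal` (★ `UnitaryGroup.«local»`,
no split ∕ non-split case distinction) and transported to the doubled group `H_v = U(𝕍 ⊕ −𝕍)(F_v)` of ★ D10 along the rational frame ★ `K2LiuLocalSiegelIwasawaFrame`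
(file B1b).  Indices `Fin 4 = {0,1,2,3}`; the relative root system is `C₂` with simple roots `α₁ = e₁ − e₂` (short, inside the Siegel Levi) and `α₂ = 2e₂` (long).
* §1 `antidiagFour` (the matrix of `J₄`) and the comm-ring constructor `unitaryOfMatrix'` (inverse `J σ(M)ᵀ J`; ★ `unitaryOfMatrix` is field-only).
* §2 THE FOUR POSITIVE ROOT LETTERS `uLongOne y` (`2e₁`: `1 + y E₀₃`, `σ y = −y`), `uLongTwo x` (`2e₂ = α₂`: `1 + x E₁₂`), `uPlus z` (`e₁+e₂`: `1 + z E₀₂ − σz E₁₃`),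
  `uMinus z` (`e₁−e₂ = α₁`: `1 + z E₀₁ − σz E₂₃`) as elements of `G`, with additivity.
* §3 THE TORUS `torusElt a b = diag(a, b, σ(b)⁻¹, σ(a)⁻¹)` and its action on the letters (the four root characters `a σ(a)`, `b σ(b)`, `a σ(b)`, `a b⁻¹`).
SEQUEL (file B1a-2 `K2LiuDoubledUTwoTwoWeylCocycle`): the Weyl letters `w₁ = perm (0 1)(2 3)`, `w₂ = perm (1 2)`, the Siegel data `w_Δ = w₂ w₁ w₂`,
`n(x,z,y) = u_{2e₂}(x) u_{e₁+e₂}(z) u_{2e₁}(y)` and the COCYCLE WORD `w_Δ n(x,z,y) = (w₂u₂(y))(w₁u₁(z))(w₂u₂(x))` (the `≤ 400`-line rule splits the topic).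
HONEST LABEL.  Carriers only, count-neutral: `HC_CM` is proved only modulo the 7 printed citations (2 remaining named inputs: hLiu418 = `stmt-HodgeConjecture-24832`,
h413 = `stmt-HodgeConjecture-24833`) until rung 0 closes.

## References
* [Casselman1980] W. Casselman, *The unramified principal series of p-adic groups I*, Compositio Math. 40 (1980): §3 (rank-one operators `T_{w}`, the cocycle
  `T_{w₁w₂} = T_{w₁}T_{w₂}` for `ℓ(w₁w₂) = ℓ(w₁)+ℓ(w₂)`, `c_α`).
* [Mok2014] C. P. Mok, Mem. AMS 235 (2015): §1 Notation p. 5 (`J_N`, `U_{E/F}(N)`, its Borel pair).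
* [HarrisKudlaSweet1996] M. Harris, S. Kudla, W. J. Sweet, J. AMS 9 (1996): §1 (1.11)–(1.12), §6 (6.14)–(6.16) (`P_Δ = M_Δ N_Δ`, `w_Δ`, the `c`-function product).
* [Rogawski1990] J. Rogawski, *Automorphic representations of unitary groups in three variables* (1990): §1.9 (root subgroups of quasi-split unitary groups).
-/

set_option autoImplicit false
set_option linter.dupNamespace false -- the mandated namespace repeats `HodgeConjecture.HodgeConjecture`

noncomputable section

open Matrix
open Literature.NumberTheory.Automorphic

namespace Summit.HodgeConjecture.HodgeConjecture.Cruxes.HLiu418.K2LiuDoubledUTwoTwoBorelFrame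

variable (R : Type*) [CommRing R] (σ : R →+* R)

/-! ## §1 The form `J₄` and a constructor of unitary elements over a commutative ring -/

/-- **the matrix of `J₄ = antidiag(1,1,1,1)`** written out. [cite: Mok2014, §1 Notation p. 5] -/
def antidiagFour : Matrix (Fin 4) (Fin 4) R := !![0, 0, 0, 1; 0, 0, 1, 0; 0, 1, 0, 0; 1, 0, 0, 0]

/-- `(StdForm.antidiagonal 4).over R = antidiagFour`. [cite: Mok2014, §1 Notation p. 5] -/
theorem antidiagonal_over_four : (StdForm.antidiagonal 4).over R = antidiagFour R := by
  ext i j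
  rw [StdForm.over, Matrix.map_apply, StdForm.antidiagonal_J_apply]
  fin_cases i <;> fin_cases j <;> simp [antidiagFour, Fin.rev]

/-- `J₄ · J₄ = 1`. [cite: Mok2014, §1 Notation p. 5] -/
theorem antidiagFour_mul_self : antidiagFour R * antidiagFour R = 1 := by
  rw [← antidiagonal_over_four]; exact StdForm.over_mul_over _ R

/-- `J₄` is fixed by `σ` entrywise. [cite: Mok2014, §1 Notation p. 5] -/
theorem antidiagFour_map : (antidiagFour R).map σ = antidiagFour R := by
  rw [← antidiagonal_over_four, StdForm.over_map]

/-- `J₄ᵀ = J₄`. [cite: Mok2014, §1 Notation p. 5] -/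
theorem antidiagFour_transpose : (antidiagFour R)ᵀ = antidiagFour R := by
  rw [← antidiagonal_over_four, StdForm.transpose_over]

/-- **constructor over a commutative ring**: a matrix `M` with `σ(M)ᵀ J₄ M = J₄` is a unit (inverse `J₄ σ(M)ᵀ J₄`) and an element of `U(J₄)(R, σ)`
(★ `unitaryOfMatrix` needs a field). [cite: Rogawski1990, §1.9 p. 13] [cite: Mok2014, §1 Notation p. 5] -/
def unitaryOfMatrix' (M : Matrix (Fin 4) (Fin 4) R) (hM : (M.map σ)ᵀ * antidiagFour R * M = antidiagFour R) :
    unitaryGroupOfForm σ ((StdForm.antidiagonal 4).over R) :=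
  ⟨⟨M, antidiagFour R * (M.map σ)ᵀ * antidiagFour R,
    mul_eq_one_comm.1 (by rw [Matrix.mul_assoc (antidiagFour R), Matrix.mul_assoc (antidiagFour R), hM, antidiagFour_mul_self]),
    by rw [Matrix.mul_assoc (antidiagFour R), Matrix.mul_assoc (antidiagFour R), hM, antidiagFour_mul_self]⟩,
    by rw [mem_unitaryGroupOfForm_iff, antidiagonal_over_four]; exact hM⟩

/-- underlying matrix of `unitaryOfMatrix'`. [cite: Mok2014, §1 Notation p. 5] -/
@[simp] theorem coe_unitaryOfMatrix' (M : Matrix (Fin 4) (Fin 4) R) (hM : (M.map σ)ᵀ * antidiagFour R * M = antidiagFour R) :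
    (((unitaryOfMatrix' R σ M hM : unitaryGroupOfForm σ ((StdForm.antidiagonal 4).over R)) : GL (Fin 4) R) : Matrix (Fin 4) (Fin 4) R) = M :=
  rfl

variable {R σ} in
/-- two elements of `U(J₄)` with the same matrix are equal. [cite: Mok2014, §1 Notation p. 5] -/
theorem ext_of_coe {g h : unitaryGroupOfForm σ ((StdForm.antidiagonal 4).over R)}
    (e : ((g : GL (Fin 4) R) : Matrix (Fin 4) (Fin 4) R) = ((h : GL (Fin 4) R) : Matrix (Fin 4) (Fin 4) R)) : g = h :=
  Subtype.ext (Units.ext e)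

/-! ## §2 The four positive root letters -/

/-- matrix of the root letter `u_{2e₁}(y) = 1 + y E₀₃`. [cite: Rogawski1990, §1.9] -/
def uLongOneM (y : R) : Matrix (Fin 4) (Fin 4) R := !![1, 0, 0, y; 0, 1, 0, 0; 0, 0, 1, 0; 0, 0, 0, 1]

/-- matrix of the root letter `u_{2e₂}(x) = 1 + x E₁₂` (simple long root `α₂`). [cite: Rogawski1990, §1.9] -/
def uLongTwoM (x : R) : Matrix (Fin 4) (Fin 4) R := !![1, 0, 0, 0; 0, 1, x, 0; 0, 0, 1, 0; 0, 0, 0, 1]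

/-- matrix of the root letter `u_{e₁+e₂}(z) = 1 + z E₀₂ − σ(z) E₁₃`. [cite: Rogawski1990, §1.9] -/
def uPlusM (z : R) : Matrix (Fin 4) (Fin 4) R := !![1, 0, z, 0; 0, 1, 0, -σ z; 0, 0, 1, 0; 0, 0, 0, 1]

/-- matrix of the root letter `u_{e₁−e₂}(z) = 1 + z E₀₁ − σ(z) E₂₃` (simple short root `α₁`, inside the Siegel Levi). [cite: Rogawski1990, §1.9] -/
def uMinusM (z : R) : Matrix (Fin 4) (Fin 4) R := !![1, z, 0, 0; 0, 1, 0, 0; 0, 0, 1, -σ z; 0, 0, 0, 1]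

variable {R σ}

/-- `u_{2e₁}(y)` is unitary when `σ y = −y`. [cite: Rogawski1990, §1.9] -/
theorem uLongOneM_unitary {y : R} (hy : σ y = -y) : ((uLongOneM R y).map σ)ᵀ * antidiagFour R * uLongOneM R y = antidiagFour R := by
  ext i j
  fin_cases i <;> fin_cases j <;> simp [uLongOneM, antidiagFour, Matrix.mul_apply, Fin.sum_univ_four, hy]

/-- `u_{2e₂}(x)` is unitary when `σ x = −x`. [cite: Rogawski1990, §1.9] -/
theorem uLongTwoM_unitary {x : R} (hx : σ x = -x) : ((uLongTwoM R x).map σ)ᵀ * antidiagFour R * uLongTwoM R x = antidiagFour R := by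
  ext i j
  fin_cases i <;> fin_cases j <;> simp [uLongTwoM, antidiagFour, Matrix.mul_apply, Fin.sum_univ_four, hx]

/-- `u_{e₁+e₂}(z)` is unitary (`σ` involutive). [cite: Rogawski1990, §1.9] -/
theorem uPlusM_unitary (hσ : ∀ x, σ (σ x) = x) (z : R) : ((uPlusM R σ z).map σ)ᵀ * antidiagFour R * uPlusM R σ z = antidiagFour R := by
  ext i j
  fin_cases i <;> fin_cases j <;> simp [uPlusM, antidiagFour, Matrix.mul_apply, Fin.sum_univ_four, hσ]

/-- `u_{e₁−e₂}(z)` is unitary (`σ` involutive). [cite: Rogawski1990, §1.9] -/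
theorem uMinusM_unitary (hσ : ∀ x, σ (σ x) = x) (z : R) : ((uMinusM R σ z).map σ)ᵀ * antidiagFour R * uMinusM R σ z = antidiagFour R := by
  ext i j
  fin_cases i <;> fin_cases j <;> simp [uMinusM, antidiagFour, Matrix.mul_apply, Fin.sum_univ_four, hσ]

variable (R σ)

/-- **the root letter `u_{2e₁}(y) ∈ U(J₄)`** for `σ y = −y` (the root group `U_{2e₁} ≅ {σ = −1} ≅ F`). [cite: Rogawski1990, §1.9] [cite: Casselman1980, §3] -/
def uLongOne (y : R) (hy : σ y = -y) : unitaryGroupOfForm σ ((StdForm.antidiagonal 4).over R) :=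
  unitaryOfMatrix' R σ (uLongOneM R y) (uLongOneM_unitary hy)

/-- **the root letter `u_{2e₂}(x) ∈ U(J₄)`** for `σ x = −x` (simple long root `α₂`). [cite: Rogawski1990, §1.9] [cite: Casselman1980, §3] -/
def uLongTwo (x : R) (hx : σ x = -x) : unitaryGroupOfForm σ ((StdForm.antidiagonal 4).over R) :=
  unitaryOfMatrix' R σ (uLongTwoM R x) (uLongTwoM_unitary hx)

/-- **the root letter `u_{e₁+e₂}(z) ∈ U(J₄)`** (`z ∈ R` arbitrary; the root group `U_{e₁+e₂} ≅ R ≅ E`). [cite: Rogawski1990, §1.9] [cite: Casselman1980, §3] -/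
def uPlus (hσ : ∀ x, σ (σ x) = x) (z : R) : unitaryGroupOfForm σ ((StdForm.antidiagonal 4).over R) :=
  unitaryOfMatrix' R σ (uPlusM R σ z) (uPlusM_unitary hσ z)

/-- **the root letter `u_{e₁−e₂}(z) ∈ U(J₄)`** (simple short root `α₁`, in the Siegel Levi). [cite: Rogawski1990, §1.9] [cite: Casselman1980, §3] -/
def uMinus (hσ : ∀ x, σ (σ x) = x) (z : R) : unitaryGroupOfForm σ ((StdForm.antidiagonal 4).over R) :=
  unitaryOfMatrix' R σ (uMinusM R σ z) (uMinusM_unitary hσ z)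

/-- matrix of `uLongOne`. [cite: Rogawski1990, §1.9] -/
@[simp] theorem coe_uLongOne (y : R) (hy : σ y = -y) :
    (((uLongOne R σ y hy : unitaryGroupOfForm σ _) : GL (Fin 4) R) : Matrix (Fin 4) (Fin 4) R) = uLongOneM R y := rfl

/-- matrix of `uLongTwo`. [cite: Rogawski1990, §1.9] -/
@[simp] theorem coe_uLongTwo (x : R) (hx : σ x = -x) :
    (((uLongTwo R σ x hx : unitaryGroupOfForm σ _) : GL (Fin 4) R) : Matrix (Fin 4) (Fin 4) R) = uLongTwoM R x := rfl

/-- matrix of `uPlus`. [cite: Rogawski1990, §1.9] -/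
@[simp] theorem coe_uPlus (hσ : ∀ x, σ (σ x) = x) (z : R) :
    (((uPlus R σ hσ z : unitaryGroupOfForm σ _) : GL (Fin 4) R) : Matrix (Fin 4) (Fin 4) R) = uPlusM R σ z := rfl

/-- matrix of `uMinus`. [cite: Rogawski1990, §1.9] -/
@[simp] theorem coe_uMinus (hσ : ∀ x, σ (σ x) = x) (z : R) :
    (((uMinus R σ hσ z : unitaryGroupOfForm σ _) : GL (Fin 4) R) : Matrix (Fin 4) (Fin 4) R) = uMinusM R σ z := rfl

/-- additivity of `u_{2e₁}`: `u(y) u(y′) = u(y + y′)`. [cite: Casselman1980, §3] -/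
theorem uLongOne_mul (y y' : R) (hy : σ y = -y) (hy' : σ y' = -y') :
    uLongOne R σ y hy * uLongOne R σ y' hy' = uLongOne R σ (y + y') (by rw [map_add, hy, hy', neg_add]) := by
  apply ext_of_coe
  rw [Subgroup.coe_mul, Units.val_mul, coe_uLongOne, coe_uLongOne, coe_uLongOne]
  ext i j
  fin_cases i <;> fin_cases j <;> simp [uLongOneM, Matrix.mul_apply, Fin.sum_univ_four, add_comm]

/-- additivity of `u_{2e₂}`. [cite: Casselman1980, §3] -/
theorem uLongTwo_mul (x x' : R) (hx : σ x = -x) (hx' : σ x' = -x') :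
    uLongTwo R σ x hx * uLongTwo R σ x' hx' = uLongTwo R σ (x + x') (by rw [map_add, hx, hx', neg_add]) := by
  apply ext_of_coe
  rw [Subgroup.coe_mul, Units.val_mul, coe_uLongTwo, coe_uLongTwo, coe_uLongTwo]
  ext i j
  fin_cases i <;> fin_cases j <;> simp [uLongTwoM, Matrix.mul_apply, Fin.sum_univ_four, add_comm]

/-- additivity of `u_{e₁+e₂}`. [cite: Casselman1980, §3] -/
theorem uPlus_mul (hσ : ∀ x, σ (σ x) = x) (z z' : R) : uPlus R σ hσ z * uPlus R σ hσ z' = uPlus R σ hσ (z + z') := by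
  apply ext_of_coe
  rw [Subgroup.coe_mul, Units.val_mul, coe_uPlus, coe_uPlus, coe_uPlus]
  ext i j
  fin_cases i <;> fin_cases j <;> simp [uPlusM, Matrix.mul_apply, Fin.sum_univ_four, add_comm]

/-- additivity of `u_{e₁−e₂}`. [cite: Casselman1980, §3] -/
theorem uMinus_mul (hσ : ∀ x, σ (σ x) = x) (z z' : R) : uMinus R σ hσ z * uMinus R σ hσ z' = uMinus R σ hσ (z + z') := by
  apply ext_of_coe
  rw [Subgroup.coe_mul, Units.val_mul, coe_uMinus, coe_uMinus, coe_uMinus]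
  ext i j
  fin_cases i <;> fin_cases j <;> simp [uMinusM, Matrix.mul_apply, Fin.sum_univ_four, add_comm]

/-- `u_{2e₁}(0) = 1`. [cite: Casselman1980, §3] -/
theorem uLongOne_zero : uLongOne R σ 0 (by rw [map_zero, neg_zero]) = 1 := by
  apply ext_of_coe
  rw [coe_uLongOne, Subgroup.coe_one, Units.val_one]
  ext i j; fin_cases i <;> fin_cases j <;> simp [uLongOneM]

/-- `u_{2e₂}(0) = 1`. [cite: Casselman1980, §3] -/
theorem uLongTwo_zero : uLongTwo R σ 0 (by rw [map_zero, neg_zero]) = 1 := by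
  apply ext_of_coe
  rw [coe_uLongTwo, Subgroup.coe_one, Units.val_one]
  ext i j; fin_cases i <;> fin_cases j <;> simp [uLongTwoM]

/-- `u_{e₁+e₂}(0) = 1`. [cite: Casselman1980, §3] -/
theorem uPlus_zero (hσ : ∀ x, σ (σ x) = x) : uPlus R σ hσ 0 = 1 := by
  apply ext_of_coe
  rw [coe_uPlus, Subgroup.coe_one, Units.val_one]
  ext i j; fin_cases i <;> fin_cases j <;> simp [uPlusM]

/-- `u_{e₁−e₂}(0) = 1`. [cite: Casselman1980, §3] -/
theorem uMinus_zero (hσ : ∀ x, σ (σ x) = x) : uMinus R σ hσ 0 = 1 := by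
  apply ext_of_coe
  rw [coe_uMinus, Subgroup.coe_one, Units.val_one]
  ext i j; fin_cases i <;> fin_cases j <;> simp [uMinusM]

/-! ## §3 The torus `T = {diag(a, b, σ(b)⁻¹, σ(a)⁻¹)} ≅ (Rˣ)²` and its action on the root letters -/

/-- matrix of the torus element `t(a,b) = diag(a, b, σ(b⁻¹), σ(a⁻¹))`. [cite: Mok2014, §1 Notation p. 5] -/
def torusM (a b : Rˣ) : Matrix (Fin 4) (Fin 4) R :=
  !![(a : R), 0, 0, 0; 0, (b : R), 0, 0; 0, 0, σ ((b⁻¹ : Rˣ) : R), 0; 0, 0, 0, σ ((a⁻¹ : Rˣ) : R)]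

variable {R σ} in
/-- `t(a,b)` is unitary (`σ` involutive). [cite: Mok2014, §1 Notation p. 5] -/
theorem torusM_unitary (hσ : ∀ x, σ (σ x) = x) (a b : Rˣ) : ((torusM R σ a b).map σ)ᵀ * antidiagFour R * torusM R σ a b = antidiagFour R := by
  ext i j
  fin_cases i <;> fin_cases j <;> simp [torusM, antidiagFour, Matrix.mul_apply, Fin.sum_univ_four, hσ, ← map_mul]

/-- **the torus element `t(a,b) = diag(a, b, σ(b)⁻¹, σ(a)⁻¹) ∈ U(J₄)`** (`T ≅ (E_wˣ)²` at a place). [cite: Mok2014, §1 Notation p. 5] [cite: Casselman1980, §3] -/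
def torusElt (hσ : ∀ x, σ (σ x) = x) (a b : Rˣ) : unitaryGroupOfForm σ ((StdForm.antidiagonal 4).over R) :=
  unitaryOfMatrix' R σ (torusM R σ a b) (torusM_unitary hσ a b)

/-- matrix of `torusElt`. [cite: Mok2014, §1 Notation p. 5] -/
@[simp] theorem coe_torusElt (hσ : ∀ x, σ (σ x) = x) (a b : Rˣ) :
    (((torusElt R σ hσ a b : unitaryGroupOfForm σ _) : GL (Fin 4) R) : Matrix (Fin 4) (Fin 4) R) = torusM R σ a b := rfl

/-- `t(a,b) t(a′,b′) = t(a a′, b b′)`. [cite: Casselman1980, §3] -/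
theorem torusElt_mul (hσ : ∀ x, σ (σ x) = x) (a b a' b' : Rˣ) :
    torusElt R σ hσ a b * torusElt R σ hσ a' b' = torusElt R σ hσ (a * a') (b * b') := by
  apply ext_of_coe
  rw [Subgroup.coe_mul, Units.val_mul, coe_torusElt, coe_torusElt, coe_torusElt]
  ext i j
  fin_cases i <;> fin_cases j <;> simp [torusM, Matrix.mul_apply, Fin.sum_univ_four, mul_comm]

/-- `t(1,1) = 1`. [cite: Casselman1980, §3] -/
theorem torusElt_one (hσ : ∀ x, σ (σ x) = x) : torusElt R σ hσ 1 1 = 1 := by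
  apply ext_of_coe
  rw [coe_torusElt, Subgroup.coe_one, Units.val_one]
  ext i j; fin_cases i <;> fin_cases j <;> simp [torusM]

/-- **root character of `2e₁`**: `t(a,b) u_{2e₁}(y) t(a,b)⁻¹ = u_{2e₁}(a σ(a) y)`. [cite: Casselman1980, §3] [cite: Rogawski1990, §1.9] -/
theorem torusElt_mul_uLongOne (hσ : ∀ x, σ (σ x) = x) (a b : Rˣ) (y : R) (hy : σ y = -y) :
    torusElt R σ hσ a b * uLongOne R σ y hy =
      uLongOne R σ ((a : R) * σ (a : R) * y) (by rw [map_mul, map_mul, hσ, hy, mul_neg, mul_comm (σ (a : R))]) * torusElt R σ hσ a b := by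
  apply ext_of_coe
  rw [Subgroup.coe_mul, Units.val_mul, Subgroup.coe_mul, Units.val_mul, coe_torusElt, coe_uLongOne, coe_uLongOne]
  ext i j
  have hA : σ (a : R) * σ ((a⁻¹ : Rˣ) : R) = 1 := by rw [← map_mul, Units.mul_inv, map_one]
  fin_cases i <;> fin_cases j <;> simp [torusM, uLongOneM, Matrix.mul_apply, Fin.sum_univ_four]
  linear_combination (-((a : R) * y)) * hA

/-- **root character of `2e₂`**: `t(a,b) u_{2e₂}(x) t(a,b)⁻¹ = u_{2e₂}(b σ(b) x)`. [cite: Casselman1980, §3] [cite: Rogawski1990, §1.9] -/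
theorem torusElt_mul_uLongTwo (hσ : ∀ x, σ (σ x) = x) (a b : Rˣ) (x : R) (hx : σ x = -x) :
    torusElt R σ hσ a b * uLongTwo R σ x hx =
      uLongTwo R σ ((b : R) * σ (b : R) * x) (by rw [map_mul, map_mul, hσ, hx, mul_neg, mul_comm (σ (b : R))]) * torusElt R σ hσ a b := by
  apply ext_of_coe
  rw [Subgroup.coe_mul, Units.val_mul, Subgroup.coe_mul, Units.val_mul, coe_torusElt, coe_uLongTwo, coe_uLongTwo]
  ext i j
  have hB : σ (b : R) * σ ((b⁻¹ : Rˣ) : R) = 1 := by rw [← map_mul, Units.mul_inv, map_one]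
  fin_cases i <;> fin_cases j <;> simp [torusM, uLongTwoM, Matrix.mul_apply, Fin.sum_univ_four]
  linear_combination (-((b : R) * x)) * hB

/-- **root character of `e₁+e₂`**: `t(a,b) u_{e₁+e₂}(z) t(a,b)⁻¹ = u_{e₁+e₂}(a σ(b) z)`. [cite: Casselman1980, §3] [cite: Rogawski1990, §1.9] -/
theorem torusElt_mul_uPlus (hσ : ∀ x, σ (σ x) = x) (a b : Rˣ) (z : R) :
    torusElt R σ hσ a b * uPlus R σ hσ z = uPlus R σ hσ ((a : R) * σ (b : R) * z) * torusElt R σ hσ a b := by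
  apply ext_of_coe
  rw [Subgroup.coe_mul, Units.val_mul, Subgroup.coe_mul, Units.val_mul, coe_torusElt, coe_uPlus, coe_uPlus]
  ext i j
  have hA : σ (a : R) * σ ((a⁻¹ : Rˣ) : R) = 1 := by rw [← map_mul, Units.mul_inv, map_one]
  have hB : σ (b : R) * σ ((b⁻¹ : Rˣ) : R) = 1 := by rw [← map_mul, Units.mul_inv, map_one]
  fin_cases i <;> fin_cases j <;> simp [torusM, uPlusM, Matrix.mul_apply, Fin.sum_univ_four, hσ]
  · linear_combination (-((a : R) * z)) * hB
  · linear_combination (-((b : R) * σ z)) * hA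

/-- **root character of `e₁−e₂`**: `t(a,b) u_{e₁−e₂}(z) t(a,b)⁻¹ = u_{e₁−e₂}(a b⁻¹ z)`. [cite: Casselman1980, §3] [cite: Rogawski1990, §1.9] -/
theorem torusElt_mul_uMinus (hσ : ∀ x, σ (σ x) = x) (a b : Rˣ) (z : R) :
    torusElt R σ hσ a b * uMinus R σ hσ z = uMinus R σ hσ ((a : R) * ((b⁻¹ : Rˣ) : R) * z) * torusElt R σ hσ a b := by
  apply ext_of_coe
  rw [Subgroup.coe_mul, Units.val_mul, Subgroup.coe_mul, Units.val_mul, coe_torusElt, coe_uMinus, coe_uMinus]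
  ext i j
  have hA : σ (a : R) * σ ((a⁻¹ : Rˣ) : R) = 1 := by rw [← map_mul, Units.mul_inv, map_one]
  have hB' : ((b⁻¹ : Rˣ) : R) * (b : R) = 1 := Units.inv_mul b
  fin_cases i <;> fin_cases j <;> simp [torusM, uMinusM, Matrix.mul_apply, Fin.sum_univ_four]
  · linear_combination (-(z * (a : R))) * hB'
  · linear_combination (-(σ ((b⁻¹ : Rˣ) : R) * σ z)) * hA

end Summit.HodgeConjecture.HodgeConjecture.Cruxes.HLiu418.K2LiuDoubledUTwoTwoBorelFrame

end
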